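import Literature.AlgebraicGeometry.AbelianSchemes.DualPairFibreDimOfConnectedStage
import HarnessLib

/-!
# Relative dimension of the dual: transport along the uniqueness isomorphism `Â' ≅ Â` of two dual pairs of one abelian scheme,
# and `dim Â_s = dim A_s` ∕ the W-line binder `hdim` from the two relative-dimension clauses `A.IsOfRelDim g`, `Â.IsOfRelDim g`

Topic `AlgebraicGeometry/AbelianSchemes`; namespace `Literature.AlgebraicGeometry.AbelianSchemes.AbelianSchemeOver(.IsOfRelDim ∕ .DualPair)`.
THEOREMS ONLY (no definition, no structure, no instance, no named fact, no `sorry`); letter-FREE (pure ★ + Mathlib); books 0.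

Cell hodgecm-mathlib (D-0151), P6 «MOD programme», **(s2-D) GLUE, FILE 1 of 2** (LEAD F0P6-plan (g2) RULING «M-29 — DUAL-S NOW»
2026-09-01T22:44:56Z (3)∕(5); director s1096 (2); B-p04 (g40) heir by lineage).  On the road of record the stage dual pair of the GEN spine
is ONE token `dual := dualPairOf hDUALS univ` over the P-2′ «DUAL-S» letter (★-cand `DualAbelianSchemeExistsLetter`, whose clause (ii) gives
`(dualPairOf hDUALS univ).hat.IsOfRelDim g` for THAT chosen dual); FILE 2 (`DualPairHatRelDimOfDualExists`, importing the letter) moves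
clause (ii) to EVERY dual pair and every field point.  This file is the letter-free transport kit both use:
* **`IsOfRelDim.of_iso_left` ∕ `IsOfRelDim.of_iso`** — relative dimension `g` transports along an isomorphism of the underlying schemes
  over `S` (Mathlib: an isomorphism is `SmoothOfRelativeDimension 0`, composition adds relative dimensions);
* **`DualPair.isOfRelDim_hat_of_dualPair`** (+ `_iff_`) — two dual pairs `D, D'` of the SAME abelian scheme have isomorphic duals over `S`
  (★ `DualPair.hatTransportIso` at `e = e' = 𝟙_A`, [MilneAV2008] I §8 «unique») so `D.hat.IsOfRelDim g → D'.hat.IsOfRelDim g` — the GEN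
  spine may therefore keep `dual` an ARBITRARY binder of `RGDInputsAt`∕`ModuliDatum` and still read clause (ii);
* `DualPair.isOfRelDim_hat_baseChange` — `(D.baseChange f).hat.IsOfRelDim g` (definitional ★ `baseChange_hat` + ★ `IsOfRelDim.baseChange`);
* `DualPair.dim_hat_fibre_eq_of_isOfRelDim` — `dim Â_s = dim A_s` at every field-valued point (★ `dim_fibre_of_isOfRelDim` twice);
  over a field `dim_toAffine_toAbelianVariety_of_isOfRelDim`, `isOfRelDim_dim_toAffine`, `DualPair.dim_hat_toAbelianVariety_eq_of_isOfRelDim`;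
* **`DualPair.dim_hat_baseChange_baseChange_eq_of_isOfRelDim`** — the W-line's LITERAL binder `hdim : D′.hat.toAffine.toAbelianVariety.dim =
  A′.dim` at the P6 special fibre `A′ := ((univ.baseChange ι_s).baseChange x̄).toAffine.toAbelianVariety`, `D′ := (dual.baseChange ι_s).baseChange x̄`
  = the Defs helper `dual₀Of 𝓜 w univ dual x̄` ON THE NOSE, from `univ.IsOfRelDim g` (GEN `RGDInputsAt.relDim`) and `dual.hat.IsOfRelDim g`
  (★ `DualPair.dim_hat_baseChange_baseChange_eq` packaging) — no characteristic-zero witness point, no connectedness, no polarisation.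
HC_CM is proved only modulo the printed citations (2 remaining named inputs hLiu418 24832, h413 24833) until rung 0 closes; this file is
count-neutral and discharges none of them.

## References
* [GortzWedhorn2023] U. Görtz, T. Wedhorn, *Algebraic Geometry II* (2023), Thm. 27.198 (2) (pp. 679–680) «`X^t` is representable by an
  abelian scheme with `dim(X^t∕S) = dim(X∕S)`», Remark 27.218 (1) (p. 689) (the Poincaré bundle is compatible with base change).
* [MilneAV2008] J. S. Milne, *Abelian Varieties* (v2.00, 2008), I §8 pp. 36–37 (the dual pair is unique up to a unique isomorphism;
  Rem. 8.8 «`dim A^∨ = dim A`»).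
* [MumfordAV1970] D. Mumford, *Abelian Varieties* (1970), §13 Cor. 3 (p. 130).
* [MumfordFogartyKirwan1994] D. Mumford, J. Fogarty, F. Kirwan, *Geometric Invariant Theory*, 3rd ed. (1994), Ch. 6 §1 Cor. 6.8 (p. 118),
  Ch. 7 §2 Definition 7.2 (p. 129) (relative dimension of an abelian scheme).
* [GortzWedhorn2020] U. Görtz, T. Wedhorn, *Algebraic Geometry I*, 2nd ed. (2020), Remark 16.54 (p. 539) (relative dimension, fibres),
  Section (4.7) (base change).
* Tree: ★ `AbelianSchemeDualTransport` (`DualPair.hatTransportIso`, `hatTransport_comp_hom`), ★ `AbelianSchemeDualPairBaseChange`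
  (`DualPair.baseChange`, `baseChange_hat`), ★ `AbelianSchemeOverFibreDim` (`dim_fibre_of_isOfRelDim`), ★ `AbelianSchemeOverField`
  (`AbelianScheme.isOfRelDim_dim`), ★ `AbelianSchemeOverBase` (`isOfRelDim_iff`, `isOfRelDim_toAffine_iff`, `IsOfRelDim.baseChange`), ★
  `DualPairFibreDimOfConnectedStage` (`DualPair.dim_hat_baseChange_baseChange_eq`, `DualPair.dim_hat_baseChange_eq`), ★
  `Motives/AbelianVarietyProofs` (`eq_of_smoothOfRelativeDimension`).
-/

set_option autoImplicit false

noncomputable section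

universe u

open CategoryTheory CategoryTheory.Limits AlgebraicGeometry

namespace Literature.AlgebraicGeometry.AbelianSchemes

namespace AbelianSchemeOver

/-! ### §1 Relative dimension along an isomorphism over `S`; two dual pairs of one abelian scheme -/

section AnyUniverse

variable {S : Scheme.{u}}

/-- **Relative dimension `g` transports along an isomorphism of the underlying schemes over `S`**: if `e : A ≅ B` (as schemes)
with `e ≫ π_B = π_A` and `B → S` is smooth of relative dimension `g`, so is `A → S` (an isomorphism is smooth of relative dimension
`0`, and relative dimensions add under composition — Mathlib `SmoothOfRelativeDimension`). [cite: GortzWedhorn2020, Remark 16.54 (p. 539)] -/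
theorem IsOfRelDim.of_iso_left {A B : AbelianSchemeOver S} (e : A.X.left ≅ B.X.left) (he : e.hom ≫ B.X.hom = A.X.hom) {g : ℕ}
    (h : B.IsOfRelDim g) : A.IsOfRelDim g := by
  rw [isOfRelDim_iff] at h ⊢
  rw [← he]
  have h0 : SmoothOfRelativeDimension (0 + g) (e.hom ≫ B.X.hom) := inferInstance
  rwa [Nat.zero_add] at h0

/-- The same along an isomorphism in `Over S`. [cite: GortzWedhorn2020, Remark 16.54 (p. 539)] -/
theorem IsOfRelDim.of_iso {A B : AbelianSchemeOver S} (e : A.X ≅ B.X) {g : ℕ} (h : B.IsOfRelDim g) : A.IsOfRelDim g :=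
  IsOfRelDim.of_iso_left ((Over.forget S).mapIso e) (Over.w e.hom) h

/-- **Two dual pairs of the SAME abelian scheme have duals of the same relative dimension**: the uniqueness isomorphism
`Ĥ : Â' ≅ Â` over `S` (★ `DualPair.hatTransportIso` at the identity of `A`; [MilneAV2008] I §8 «there is a unique regular map …»)
transports `IsOfRelDim g`. [cite: MilneAV2008, I §8 pp. 36–37] [cite: GortzWedhorn2023, Thm. 27.198 (2) (pp. 679–680)] -/
theorem DualPair.isOfRelDim_hat_of_dualPair {A : AbelianSchemeOver S} (D D' : A.DualPair) {g : ℕ} (h : D.hat.IsOfRelDim g) :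
    D'.hat.IsOfRelDim g := by
  haveI : IsMonHom (Iso.refl A.X).hom := inferInstanceAs (IsMonHom (𝟙 A.X))
  exact IsOfRelDim.of_iso_left (DualPair.hatTransportIso D D' (Iso.refl A.X) (Iso.refl A.X) rfl)
    (DualPair.hatTransport_comp_hom D D' (Iso.refl A.X)) h

/-- The two relative-dimension clauses are equivalent for any two dual pairs of one abelian scheme. [cite: MilneAV2008, I §8 pp. 36–37] -/
theorem DualPair.isOfRelDim_hat_iff_of_dualPair {A : AbelianSchemeOver S} (D D' : A.DualPair) (g : ℕ) :
    D.hat.IsOfRelDim g ↔ D'.hat.IsOfRelDim g :=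
  ⟨DualPair.isOfRelDim_hat_of_dualPair D D', DualPair.isOfRelDim_hat_of_dualPair D' D⟩

/-- **`dim Â_s = dim A_s` at every field-valued point** from `A.IsOfRelDim g` and `Â.IsOfRelDim g` (★ `dim_fibre_of_isOfRelDim` twice).
[cite: MumfordAV1970, §13 Cor. 3 (p. 130)] [cite: GortzWedhorn2023, Thm. 27.198 (2) (pp. 679–680)] -/
theorem DualPair.dim_hat_fibre_eq_of_isOfRelDim {A : AbelianSchemeOver S} (D : A.DualPair) {g : ℕ} (hA : A.IsOfRelDim g)
    (hD : D.hat.IsOfRelDim g) {Ω : Type u} [Field Ω] (s : Spec (.of Ω) ⟶ S) :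
    (D.hat.fibre s).toAbelianVariety.dim = (A.fibre s).toAbelianVariety.dim := by
  rw [dim_fibre_of_isOfRelDim hD s, dim_fibre_of_isOfRelDim hA s]

/-- The dual of the base-changed dual pair has relative dimension `g` (definitional: `(D.baseChange f).hat = Â ×_S T`, ★ `baseChange_hat`,
★ `IsOfRelDim.baseChange`). [cite: GortzWedhorn2023, Remark 27.218 (1) (p. 689)] [cite: GortzWedhorn2020, Remark 16.54 (p. 539)] -/
theorem DualPair.isOfRelDim_hat_baseChange {A : AbelianSchemeOver S} (D : A.DualPair) {T : Scheme.{u}} (f : T ⟶ S) {g : ℕ}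
    (hD : D.hat.IsOfRelDim g) : (D.baseChange f).hat.IsOfRelDim g :=
  hD.baseChange f

/-- Over a field: `dim A = g` for `A → Spec K` of relative dimension `g`, in the `toAffine.toAbelianVariety` currency (uniqueness of the
relative dimension of a smooth morphism with non-empty source, ★ `AbelianVarietyProofs.eq_of_smoothOfRelativeDimension`, against ★
`AbelianScheme.isOfRelDim_dim`; the same three lines as ★ `LevelStructureRefinement.dim_toAbelianVariety_of_isOfRelDim`, kept here to spare
that import). [cite: GortzWedhorn2020, Remark 16.54 (p. 539)] -/
theorem dim_toAffine_toAbelianVariety_of_isOfRelDim {K : Type u} [Field K] {A : AbelianSchemeOver (Spec (.of K))} {g : ℕ}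
    (h : A.IsOfRelDim g) : A.toAffine.toAbelianVariety.dim = g := by
  have h₂ : SmoothOfRelativeDimension A.toAffine.toAbelianVariety.dim A.toAffine.X.hom := A.toAffine.isOfRelDim_dim
  haveI : Nonempty A.toAffine.X.left := ⟨Motives.AbelianVariety.origin A.toAffine.toAbelianVariety⟩
  exact Motives.AbelianVarietyProofs.eq_of_smoothOfRelativeDimension _ h₂ h

/-- Over a field: the relative dimension of `A → Spec K` IS `dim A` (★ `AbelianScheme.isOfRelDim_dim` read on the `Over` carrier).
[cite: GortzWedhorn2020, Remark 16.54 (p. 539)] -/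
theorem isOfRelDim_dim_toAffine {K : Type u} [Field K] (A : AbelianSchemeOver (Spec (.of K))) :
    A.IsOfRelDim A.toAffine.toAbelianVariety.dim :=
  (A.isOfRelDim_toAffine_iff _).1 A.toAffine.isOfRelDim_dim

/-- Over a field: an abelian scheme `A → Spec K` with a dual pair whose dual has the relative dimension of `A` satisfies
`dim Â = dim A` in the `toAffine.toAbelianVariety` currency. [cite: MumfordAV1970, §13 Cor. 3 (p. 130)] [cite: GortzWedhorn2020, Remark 16.54 (p. 539)] -/
theorem DualPair.dim_hat_toAbelianVariety_eq_of_isOfRelDim {K : Type u} [Field K] {A : AbelianSchemeOver (Spec (.of K))} (D : A.DualPair)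
    {g : ℕ} (hA : A.IsOfRelDim g) (hD : D.hat.IsOfRelDim g) :
    D.hat.toAffine.toAbelianVariety.dim = A.toAffine.toAbelianVariety.dim := by
  rw [dim_toAffine_toAbelianVariety_of_isOfRelDim hD, dim_toAffine_toAbelianVariety_of_isOfRelDim hA]

/-- **The W-line's literal binder `hdim` from the two relative-dimension clauses**: for a dual pair `D` of `A → S` with `A.IsOfRelDim g` and
`Â.IsOfRelDim g`, every `f : T → S` and every field point `x` of `T`, `dim` of the dual in the ITERATED base change `(D ×_S T) ×_T Spec k`
equals `dim ((A ×_S T) ×_T Spec k)` in the `toAffine.toAbelianVariety` currency — at `f := ι_s`, `x := x̄` this is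
`(dual₀Of 𝓜 w univ dual x̄).hat.toAffine.toAbelianVariety.dim = (fibre₀Of 𝓜 w univ x̄).dim` ON THE NOSE (★ `DualPair.dim_hat_baseChange_baseChange_eq`
packaging of the fibre statement at `x ≫ f`). [cite: MumfordFogartyKirwan1994, Ch. 6 §1 Cor. 6.8 (p. 118)] [cite: MumfordAV1970, §13 Cor. 3 (p. 130)] -/
theorem DualPair.dim_hat_baseChange_baseChange_eq_of_isOfRelDim {A : AbelianSchemeOver S} (D : A.DualPair) {g : ℕ} (hA : A.IsOfRelDim g)
    (hD : D.hat.IsOfRelDim g) {T : Scheme.{u}} (f : T ⟶ S) {k : Type u} [Field k] (x : Spec (.of k) ⟶ T) :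
    ((D.baseChange f).baseChange x).hat.toAffine.toAbelianVariety.dim =
      ((A.baseChange f).baseChange x).toAffine.toAbelianVariety.dim :=
  D.dim_hat_baseChange_baseChange_eq f x (DualPair.dim_hat_fibre_eq_of_isOfRelDim D hA hD (x ≫ f))

/-- One base change deep: `dim (D.baseChange x).hat = dim (A.baseChange x)` (`toAffine.toAbelianVariety` currency) from the two relative-dimension
clauses. [cite: MumfordAV1970, §13 Cor. 3 (p. 130)] -/
theorem DualPair.dim_hat_baseChange_eq_of_isOfRelDim {A : AbelianSchemeOver S} (D : A.DualPair) {g : ℕ} (hA : A.IsOfRelDim g)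
    (hD : D.hat.IsOfRelDim g) {k : Type u} [Field k] (x : Spec (.of k) ⟶ S) :
    (D.baseChange x).hat.toAffine.toAbelianVariety.dim = (A.baseChange x).toAffine.toAbelianVariety.dim :=
  D.dim_hat_baseChange_eq x (DualPair.dim_hat_fibre_eq_of_isOfRelDim D hA hD x)

end AnyUniverse

end AbelianSchemeOver

end Literature.AlgebraicGeometry.AbelianSchemes

end
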